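import Mathlib
import Literature.AlgebraicGeometry.Resolution.PointBlowupHeightVectorDrops
import Summits.ResolutionOfSingularities.ResolutionOfSingularities.Theorems.WeightedInvariantLocalWeightedDropInsepNewtonMeasures
import Summits.ResolutionOfSingularities.ResolutionOfSingularities.Theorems.WeightedInvariantLocalWeightedDropInsepNewtonVMove
import Summits.ResolutionOfSingularities.ResolutionOfSingularities.Theorems.WeightedInvariantLocalWeightedDropInsepNewtonVHeight
import Summits.ResolutionOfSingularities.ResolutionOfSingularities.Theorems.WeightedInvariantLocalWeightedDropInsepNewtonHMove
import HarnessLib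

/-!
# `WeightedInvariant.LocalWeightedDrop`, line `hasse-ridge-face-selection`: a first API for Hauser–Wagner's SLOPE of a
# two-letter power series (`fiberMinPS`, `fiberSlopePS`, `slopePS`) and the law `slope(A′) = slope(A) − α₁` under the
# horizontal move (H) at equal height

Crux item stmt-ResolutionOfSingularities-8899 `LocalWeightedDrop` (route `ResolutionOfSingularities/WeightedInvariant`),
serving the door `WeightedConstruction` stmt-ResolutionOfSingularities-0571.  [OURS · L1 W4.3, chain w43, support typer
res-L1-type-o7 (seat res-D-pv-023): gap (g1) of `D/res-D-pv-023/NP-API.md` = the «slope API: `fiberMinPS`/`slopePS` lemmas —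
none exist yet» named by unit M3 (second half) / M6 of res-L1-w43-stub-3's S2iM attack plan
(`L/res-L1-w43-stub-3/S2iM-ATTACK-PLAN.md`, key S2iM `stub_charTwoInseparableReductionWon` via Hauser–Wagner 2014 Thm 2 (i));
elementary support bookkeeping for the Literature DEFINITIONS `HauserWagner2014.fiberMinPS / fiberSlopePS / slopePS`
(`Literature/AlgebraicGeometry/Resolution/PointBlowupHeightVectorDrops.lean`), which the tree had without lemmas, and the
one printed law about the slope that the proof of HW Theorem 2 (i) uses; NOT a statement of any manuscript.]

* `fiberMinPS H rig free a` (the least rigid exponent on the fibre `free = a`, `⊤` if empty): `fiberMinPS_le`,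
  `le_fiberMinPS_iff`, `fiberMinPS_eq_top_iff`, `exists_eq_fiberMinPS` (attained), `ordVarPS_le_fiberMinPS` (`β₁ ≤ β(a)`),
  `fiberMinPS_degAlongPS` (the fibre of the highest vertex: `β(α₁) = β₁`);
* `fiberSlopePS` / `slopePS`: `fiberSlopePS_eq_top_iff`, `fiberSlopePS_of_ne_top` (the formula), `fiberSlopePS_nonneg`,
  `slopePS_le_fiberSlopePS`, `le_slopePS_iff`, `exists_fiberSlopePS_eq_slopePS` (attained), `slopePS_nonneg`,
  THE QUADRANT CRITERION `slopePS_eq_top_iff` (`slope = ⊤` iff no support point has free exponent `< α₁`, i.e. the Newton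
  polygon is a quadrant in the given coordinates — Hauser–Wagner «If `N` is a quadrant, we set … `slope(F) = ∞`»);
* THE HORIZONTAL MOVE (spelling of `…InsepNewtonHMove`: `π_H^* A = X₀² A′`, old `(free, rig) = (0, 1)`, new `(rig, free) = (0, 1)`):
  `fiberMinPS_hSucc` (`β′(a) + 2 = β(a) + a`: the fibres are SHEARED), `degAlongPS_hSucc_eq_of_heightPS_eq` (equal height ⇔ equal
  `α₁`, the free order being kept), `ordVarPS_hSucc_zero_eq` (then `β₁′ + 2 = α₁ + β₁`), `fiberSlopePS_hSucc_add` and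
  **`slopePS_hSucc_add`: `slope(A′) + α₁ = slope(A)`** when `α₁(A′) = α₁(A)` — Hauser–Wagner's «`slope(F*) = slope(F) − α₁ < slope(F)`»
  (L'Enseignement Math. 60 (2014) §6.2 p. 206), here for ALL positions in given coordinates (every edge ratio drops by exactly one
  under the shear `(a, b) ↦ (a, a + b − 2)`; no «all edges of angle `< 45°`» hypothesis is needed for the given-coordinates
  statement); `slopePS_hSucc_lt` (strict drop when the slope is finite).
[cite: HauserWagner2014, §4 p. 190 l. 19–27 (slope); §6.2 p. 206 (slope under (H))]
-/

set_option linter.dupNamespace false -- mandated namespace of this single-conjunct summit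

namespace Summit.ResolutionOfSingularities.ResolutionOfSingularities.Theorems

namespace InsepNewton

open MvPowerSeries
open Literature.AlgebraicGeometry.Resolution
open Literature.AlgebraicGeometry.Resolution.HauserPerlega2024 (ordAlong)
open Literature.AlgebraicGeometry.Resolution.HauserWagner2014 (ordVarPS degAlongPS heightPS fiberMinPS fiberSlopePS slopePS)

variable {K : Type} [Field K] {σ : Type}

/-! ### `fiberMinPS H rig free a` — the least rigid exponent on the fibre `free = a` -/

/-- Unfolding `fiberMinPS` with `coeff`. -/
theorem fiberMinPS_def (H : MvPowerSeries σ K) (rig free : σ) (a : ℕ) :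
    fiberMinPS H rig free a = ⨅ (d : σ →₀ ℕ) (_ : coeff d H ≠ 0 ∧ d free = a), ((d rig : ℕ) : ℕ∞) := rfl

/-- A support point on the fibre bounds `fiberMinPS` from above. -/
theorem fiberMinPS_le {H : MvPowerSeries σ K} {rig free : σ} {a : ℕ} {d : σ →₀ ℕ} (hd : coeff d H ≠ 0)
    (hdf : d free = a) : fiberMinPS H rig free a ≤ (d rig : ℕ∞) := by
  rw [fiberMinPS_def]
  exact iInf₂_le d ⟨hd, hdf⟩

/-- Lower bounds for `fiberMinPS`. -/
theorem le_fiberMinPS_iff {H : MvPowerSeries σ K} {rig free : σ} {a : ℕ} {n : ℕ∞} :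
    n ≤ fiberMinPS H rig free a ↔ ∀ d : σ →₀ ℕ, coeff d H ≠ 0 → d free = a → n ≤ (d rig : ℕ∞) := by
  rw [fiberMinPS_def, le_iInf₂_iff]
  exact ⟨fun h d hd hdf => h d ⟨hd, hdf⟩, fun h d hd => h d hd.1 hd.2⟩

/-- THE EMPTY FIBRE: `fiberMinPS … a = ⊤` iff no support point has free exponent `a`. -/
theorem fiberMinPS_eq_top_iff {H : MvPowerSeries σ K} {rig free : σ} {a : ℕ} :
    fiberMinPS H rig free a = ⊤ ↔ ∀ d : σ →₀ ℕ, coeff d H ≠ 0 → d free ≠ a := by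
  rw [fiberMinPS_def]
  simp only [iInf_eq_top, ENat.coe_ne_top, imp_false, not_and]

/-- A non-empty fibre attains its minimum at a support point. -/
theorem exists_eq_fiberMinPS {H : MvPowerSeries σ K} {rig free : σ} {a : ℕ} (h : fiberMinPS H rig free a ≠ ⊤) :
    ∃ d : σ →₀ ℕ, coeff d H ≠ 0 ∧ d free = a ∧ ((d rig : ℕ) : ℕ∞) = fiberMinPS H rig free a := by
  classical
  by_cases hne : ∃ d : σ →₀ ℕ, coeff d H ≠ 0 ∧ d free = a
  · obtain ⟨d₀, hd₀, hd₀f⟩ := hne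
    haveI : Nonempty {d : σ →₀ ℕ // coeff d H ≠ 0 ∧ d free = a} := ⟨⟨d₀, hd₀, hd₀f⟩⟩
    obtain ⟨⟨d, hd, hdf⟩, hd'⟩ :=
      ENat.exists_eq_iInf (fun x : {d : σ →₀ ℕ // coeff d H ≠ 0 ∧ d free = a} => ((x.1 rig : ℕ) : ℕ∞))
    refine ⟨d, hd, hdf, ?_⟩
    rw [fiberMinPS_def, iInf_subtype']
    exact hd'
  · exact absurd (fiberMinPS_eq_top_iff.mpr fun d hd hdf => hne ⟨d, hd, hdf⟩) h

/-- EVERY FIBRE LIES ABOVE THE LOWEST RIGID ROW: `β₁ = ord_rig ≤ fiberMinPS … a`. -/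
theorem ordVarPS_le_fiberMinPS (H : MvPowerSeries σ K) (rig free : σ) (a : ℕ) :
    ((ordVarPS H rig : ℕ) : ℕ∞) ≤ fiberMinPS H rig free a :=
  le_fiberMinPS_iff.mpr fun _ hd _ => by exact_mod_cast ordVarPS_le rig hd

/-- THE FIBRE OF THE HIGHEST VERTEX: `fiberMinPS … α₁ = β₁` (`H ≠ 0`). -/
theorem fiberMinPS_degAlongPS {H : MvPowerSeries σ K} (hH : H ≠ 0) (rig free : σ) :
    fiberMinPS H rig free (degAlongPS H rig free) = ((ordVarPS H rig : ℕ) : ℕ∞) := by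
  refine le_antisymm ?_ (ordVarPS_le_fiberMinPS H rig free _)
  obtain ⟨d, hd, hdr, hdf⟩ := exists_vertex hH rig free
  rw [← hdr]
  exact fiberMinPS_le hd hdf

/-! ### `fiberSlopePS` and `slopePS` -/

/-- A fibre contributes `⊤` to the slope iff it is empty. -/
theorem fiberSlopePS_eq_top_iff {H : MvPowerSeries σ K} {rig free : σ} {a : ℕ} :
    fiberSlopePS H rig free a = ⊤ ↔ fiberMinPS H rig free a = ⊤ := by
  unfold fiberSlopePS
  split_ifs with h
  · exact ⟨fun _ => h, fun _ => rfl⟩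
  · exact ⟨fun h' => absurd h' WithTop.coe_ne_top, fun h' => absurd h' h⟩

/-- THE FORMULA on a non-empty fibre: `fiberSlopePS … a = α₁ · (β(a) − β₁) / (α₁ − a)`. -/
theorem fiberSlopePS_of_ne_top {H : MvPowerSeries σ K} {rig free : σ} {a : ℕ} (h : fiberMinPS H rig free a ≠ ⊤) :
    fiberSlopePS H rig free a =
      (((degAlongPS H rig free : ℚ) * ((((fiberMinPS H rig free a).toNat : ℕ) : ℚ) - (ordVarPS H rig : ℚ)) /
        ((degAlongPS H rig free : ℚ) - (a : ℚ)) : ℚ) : WithTop ℚ) := by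
  unfold fiberSlopePS
  rw [if_neg h]

/-- On a fibre to the left of the highest vertex the contribution is non-negative. -/
theorem fiberSlopePS_nonneg {H : MvPowerSeries σ K} {rig free : σ} {a : ℕ} (ha : a < degAlongPS H rig free) :
    0 ≤ fiberSlopePS H rig free a := by
  by_cases h : fiberMinPS H rig free a = ⊤
  · rw [fiberSlopePS_eq_top_iff.mpr h]
    exact le_top
  · rw [fiberSlopePS_of_ne_top h, ← WithTop.coe_zero, WithTop.coe_le_coe]
    have hβ : (ordVarPS H rig : ℚ) ≤ (((fiberMinPS H rig free a).toNat : ℕ) : ℚ) := by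
      have h1 := ordVarPS_le_fiberMinPS H rig free a
      rw [← ENat.coe_toNat h] at h1
      exact_mod_cast h1
    have hα : (a : ℚ) < (degAlongPS H rig free : ℚ) := by exact_mod_cast ha
    apply div_nonneg
    · exact mul_nonneg (Nat.cast_nonneg _) (sub_nonneg.mpr hβ)
    · exact sub_nonneg.mpr hα.le

/-- Unfolding `slopePS`: the least fibre contribution over the free exponents `a < α₁`. -/
theorem slopePS_def (H : MvPowerSeries σ K) (rig free : σ) :
    slopePS H rig free = (Finset.range (degAlongPS H rig free)).inf fun a => fiberSlopePS H rig free a := rfl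

/-- `slope ≤` every fibre contribution to the left of the highest vertex. -/
theorem slopePS_le_fiberSlopePS {H : MvPowerSeries σ K} {rig free : σ} {a : ℕ} (ha : a < degAlongPS H rig free) :
    slopePS H rig free ≤ fiberSlopePS H rig free a := by
  rw [slopePS_def]
  exact Finset.inf_le (Finset.mem_range.mpr ha)

/-- Lower bounds for the slope. -/
theorem le_slopePS_iff {H : MvPowerSeries σ K} {rig free : σ} {v : WithTop ℚ} :
    v ≤ slopePS H rig free ↔ ∀ a < degAlongPS H rig free, v ≤ fiberSlopePS H rig free a := by
  rw [slopePS_def, Finset.le_inf_iff]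
  simp only [Finset.mem_range]

/-- The slope is attained on some fibre (when there is a fibre to the left of the highest vertex at all, i.e. `α₁ > 0`). -/
theorem exists_fiberSlopePS_eq_slopePS {H : MvPowerSeries σ K} {rig free : σ} (hα : 0 < degAlongPS H rig free) :
    ∃ a < degAlongPS H rig free, fiberSlopePS H rig free a = slopePS H rig free := by
  have hne : (Finset.range (degAlongPS H rig free)).Nonempty := ⟨0, Finset.mem_range.mpr hα⟩
  obtain ⟨a, ha, h⟩ := Finset.exists_mem_eq_inf (Finset.range (degAlongPS H rig free)) hne
    (fun a => fiberSlopePS H rig free a)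
  exact ⟨a, Finset.mem_range.mp ha, by rw [slopePS_def, h]⟩

/-- The slope is non-negative. -/
theorem slopePS_nonneg (H : MvPowerSeries σ K) (rig free : σ) : 0 ≤ slopePS H rig free :=
  le_slopePS_iff.mpr fun _ ha => fiberSlopePS_nonneg ha

/-- **THE QUADRANT CRITERION**: `slope = ⊤` iff every fibre `a < α₁` is empty, i.e. no support point has free exponent `< α₁`
(the Newton polygon in the given coordinates is the quadrant `(α₁, β₁) + ℝ²₊`). [cite: HauserWagner2014, §4 p. 190 l. 26–27] -/
theorem slopePS_eq_top_iff {H : MvPowerSeries σ K} {rig free : σ} :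
    slopePS H rig free = ⊤ ↔ ∀ d : σ →₀ ℕ, coeff d H ≠ 0 → degAlongPS H rig free ≤ d free := by
  rw [slopePS_def, Finset.inf_eq_top_iff]
  simp only [Finset.mem_range, fiberSlopePS_eq_top_iff, fiberMinPS_eq_top_iff]
  constructor
  · intro h d hd
    by_contra hlt
    exact h (d free) (not_le.mp hlt) d hd rfl
  · intro h a ha d hd hdf
    have := h d hd
    omega

/-! ### The slope under the horizontal move (H) — spelling of `…InsepNewtonHMove`

Before the move `(free, rig) = (0, 1)`; the chart is `π_H : x₁ ↦ c₁ X₀, x₀ ↦ X₀ X₁` (`c₁ ≠ 0`), the successor `A′` is defined by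
`π_H^* A = X₀² A′`, and after the move `(rig, free) = (0, 1)`.  On supports: `(a, b) ∈ supp A ↦ (a + b − 2, a) ∈ supp A′` read as
`(X₀, X₁)`-exponents, i.e. new `(free, rig) = (a, a + b − 2)`: each fibre `free = a` is SHEARED down by `2 − a`. -/

section HMove

variable {c₁ : K} {A A' : MvPowerSeries (Fin 2) K}

/-- THE FIBRES ARE SHEARED: `fiberMin′(a) + 2 = fiberMin(a) + a` (both sides `⊤` on an empty fibre; `A` of order `≥ 2`). -/
theorem fiberMinPS_hSucc (hc₁ : c₁ ≠ 0) (hA2 : (2 : ℕ∞) ≤ A.order)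
    (hfac : subst (fun l : Fin 2 => if l = 1 then C c₁ * X 0 else (X 0 * X 1 : MvPowerSeries (Fin 2) K)) A = X 0 ^ 2 * A')
    (a : ℕ) : fiberMinPS A' 0 1 a + 2 = fiberMinPS A 1 0 a + a := by
  refine le_antisymm ?_ ?_
  · -- a point `(a, b)` of the old fibre gives the point `(a + b − 2, a)` of the new one
    by_cases h : fiberMinPS A 1 0 a = ⊤
    · rw [h, top_add]
      exact le_top
    obtain ⟨d, hd', hdf, hdr⟩ := exists_eq_fiberMinPS h
    have hd := coeff_single_add_single_ne_zero hd'
    have h2 := two_le_add_of_coeff_ne_zero hA2 hd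
    have h' := coeff_hSucc_ne_zero_of hc₁ hfac h2 hd
    have hle := fiberMinPS_le (rig := 0) (free := 1) h' (by rw [pair_apply_one, hdf])
    rw [pair_apply_zero] at hle
    rw [← hdr]
    calc fiberMinPS A' 0 1 a + 2 ≤ ((d 0 + d 1 - 2 : ℕ) : ℕ∞) + 2 := add_le_add hle le_rfl
      _ = ((d 1 : ℕ) : ℕ∞) + a := by
          rw [← hdf]
          exact_mod_cast (by omega : d 0 + d 1 - 2 + 2 = d 1 + d 0)
  · -- a point `(e₀, a)` of the new fibre comes from the point `(a, e₀ + 2 − a)` of the old one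
    by_cases h : fiberMinPS A' 0 1 a = ⊤
    · rw [h, top_add]
      exact le_top
    obtain ⟨e, he', hef, her⟩ := exists_eq_fiberMinPS h
    have he := coeff_single_add_single_ne_zero he'
    obtain ⟨hb, h'⟩ := (coeff_hSucc_ne_zero_iff hc₁ hfac (e 0) (e 1)).mp he
    have hle := fiberMinPS_le (rig := 1) (free := 0) h' (by rw [pair_apply_zero, hef])
    rw [pair_apply_one] at hle
    rw [← her]
    calc fiberMinPS A 1 0 a + a ≤ ((e 0 + 2 - e 1 : ℕ) : ℕ∞) + a := add_le_add hle le_rfl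
      _ = ((e 0 : ℕ) : ℕ∞) + 2 := by
          rw [← hef]
          exact_mod_cast (by omega : e 0 + 2 - e 1 + e 1 = e 0 + 2)

/-- EQUAL HEIGHT UNDER (H) MEANS EQUAL `α₁` (the free order is kept, `ordVarPS_hSucc_one`). -/
theorem degAlongPS_hSucc_eq_of_heightPS_eq (hc₁ : c₁ ≠ 0) (hA : A ≠ 0) (hA2 : (2 : ℕ∞) ≤ A.order)
    (hfac : subst (fun l : Fin 2 => if l = 1 then C c₁ * X 0 else (X 0 * X 1 : MvPowerSeries (Fin 2) K)) A = X 0 ^ 2 * A')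
    (hh : heightPS A' 0 1 = heightPS A 1 0) : degAlongPS A' 0 1 = degAlongPS A 1 0 := by
  have hA' := hSucc_ne_zero hc₁ hA hA2 hfac
  have h1 := ordVarPS_hSucc_one hc₁ hA hA2 hfac
  have h2 := ordVarPS_le_degAlongPS hA' 0 1
  have h3 := ordVarPS_le_degAlongPS hA 1 0
  unfold heightPS at hh
  omega

/-- AT EQUAL `α₁` THE NEW LOWEST ROW IS THE IMAGE OF THE OLD HIGHEST VERTEX: `β₁′ + 2 = α₁ + β₁` (so `ord A = α₁ + β₁`: the old
highest vertex lies on the initial line). -/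
theorem ordVarPS_hSucc_zero_eq (hc₁ : c₁ ≠ 0) (hA : A ≠ 0) (hA2 : (2 : ℕ∞) ≤ A.order)
    (hfac : subst (fun l : Fin 2 => if l = 1 then C c₁ * X 0 else (X 0 * X 1 : MvPowerSeries (Fin 2) K)) A = X 0 ^ 2 * A')
    (hdeg : degAlongPS A' 0 1 = degAlongPS A 1 0) : ordVarPS A' 0 + 2 = degAlongPS A 1 0 + ordVarPS A 1 := by
  have hA' := hSucc_ne_zero hc₁ hA hA2 hfac
  have hz := ordVarPS_hSucc_zero hc₁ hA hA2 hfac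
  refine le_antisymm ?_ ?_
  · -- `ord A ≤ α₁ + β₁`: the old vertex is a support point
    obtain ⟨v, hv', hv1, hv0⟩ := exists_vertex hA 1 0
    have hv := coeff_single_add_single_ne_zero hv'
    have hle := order_le hv
    rw [degree_pair, ← hz] at hle
    have hle' : ordVarPS A' 0 + 2 ≤ v 0 + v 1 := by exact_mod_cast hle
    omega
  · -- the new vertex `(β₁′, α₁)` comes from the old point `(α₁, β₁′ + 2 − α₁)`, whose rigid exponent is `≥ β₁`
    obtain ⟨w, hw', hw0, hw1⟩ := exists_vertex hA' 0 1
    have hw := coeff_single_add_single_ne_zero hw'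
    obtain ⟨hb, h'⟩ := (coeff_hSucc_ne_zero_iff hc₁ hfac (w 0) (w 1)).mp hw
    have hβ := ordVarPS_le 1 h'
    rw [pair_apply_one] at hβ
    omega

/-- THE FIBRE CONTRIBUTIONS DROP BY EXACTLY `α₁` under (H) at equal `α₁`: `fiberSlope′(a) + α₁ = fiberSlope(a)` for `a < α₁`
(every edge ratio `(β − β₁)/(α₁ − a)` drops by one under the shear). -/
theorem fiberSlopePS_hSucc_add (hc₁ : c₁ ≠ 0) (hA : A ≠ 0) (hA2 : (2 : ℕ∞) ≤ A.order)
    (hfac : subst (fun l : Fin 2 => if l = 1 then C c₁ * X 0 else (X 0 * X 1 : MvPowerSeries (Fin 2) K)) A = X 0 ^ 2 * A')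
    (hdeg : degAlongPS A' 0 1 = degAlongPS A 1 0) {a : ℕ} (ha : a < degAlongPS A 1 0) :
    fiberSlopePS A' 0 1 a + (degAlongPS A 1 0 : WithTop ℚ) = fiberSlopePS A 1 0 a := by
  have hfib := fiberMinPS_hSucc hc₁ hA2 hfac a
  have hβ := ordVarPS_hSucc_zero_eq hc₁ hA hA2 hfac hdeg
  by_cases h : fiberMinPS A 1 0 a = ⊤
  · -- empty fibre on both sides
    have h' : fiberMinPS A' 0 1 a = ⊤ := by
      rw [h, top_add] at hfib
      by_contra hne
      rw [← ENat.coe_toNat hne] at hfib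
      exact WithTop.coe_ne_top (by exact_mod_cast hfib)
    rw [fiberSlopePS_eq_top_iff.mpr h, fiberSlopePS_eq_top_iff.mpr h', top_add]
  · have h' : fiberMinPS A' 0 1 a ≠ ⊤ := by
      intro h'
      rw [h', top_add] at hfib
      rw [← ENat.coe_toNat h] at hfib
      exact WithTop.coe_ne_top (by exact_mod_cast hfib.symm)
    -- the two minima as natural numbers: `m′ + 2 = m + a`
    set m := (fiberMinPS A 1 0 a).toNat with hm
    set m' := (fiberMinPS A' 0 1 a).toNat with hm'
    have hmm : m' + 2 = m + a := by
      rw [← ENat.coe_toNat h, ← ENat.coe_toNat h'] at hfib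
      exact_mod_cast hfib
    -- `β₁ ≤ m`
    have hβm : ordVarPS A 1 ≤ m := by
      have h1 := ordVarPS_le_fiberMinPS A 1 0 a
      rw [← ENat.coe_toNat h] at h1
      exact_mod_cast h1
    rw [fiberSlopePS_of_ne_top h, fiberSlopePS_of_ne_top h', hdeg, ← WithTop.coe_natCast, ← WithTop.coe_add, WithTop.coe_eq_coe]
    have hα : ((degAlongPS A 1 0 : ℚ) - (a : ℚ)) ≠ 0 := by
      have : (a : ℚ) < (degAlongPS A 1 0 : ℚ) := by exact_mod_cast ha
      linarith
    have hm'q : ((m' : ℕ) : ℚ) = (m : ℚ) + (a : ℚ) - 2 := by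
      have : ((m' + 2 : ℕ) : ℚ) = ((m + a : ℕ) : ℚ) := by rw [hmm]
      push_cast at this
      linarith
    have hβq : ((ordVarPS A' 0 : ℕ) : ℚ) = (degAlongPS A 1 0 : ℚ) + (ordVarPS A 1 : ℚ) - 2 := by
      have : ((ordVarPS A' 0 + 2 : ℕ) : ℚ) = ((degAlongPS A 1 0 + ordVarPS A 1 : ℕ) : ℚ) := by rw [hβ]
      push_cast at this
      linarith
    rw [← hm', ← hm, hm'q, hβq]
    field_simp
    ring

/-- **HAUSER–WAGNER, MOVE (H) AT EQUAL HEIGHT: THE SLOPE DROPS BY `α₁`** — `slope(A′) + α₁ = slope(A)` for the horizontal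
successor whenever `α₁(A′) = α₁(A)` (given coordinates; `A ≠ 0` of order `≥ 2`, `c₁ ≠ 0`; `⊤ + α₁ = ⊤` covers the quadrant case).
[cite: HauserWagner2014, §6.2 p. 206 («slope(F*) = slope(F) − α₁ < slope(F)»)] -/
theorem slopePS_hSucc_add (hc₁ : c₁ ≠ 0) (hA : A ≠ 0) (hA2 : (2 : ℕ∞) ≤ A.order)
    (hfac : subst (fun l : Fin 2 => if l = 1 then C c₁ * X 0 else (X 0 * X 1 : MvPowerSeries (Fin 2) K)) A = X 0 ^ 2 * A')
    (hdeg : degAlongPS A' 0 1 = degAlongPS A 1 0) :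
    slopePS A' 0 1 + (degAlongPS A 1 0 : WithTop ℚ) = slopePS A 1 0 := by
  rw [slopePS_def, slopePS_def, hdeg]
  set s := Finset.range (degAlongPS A 1 0) with hs
  by_cases hne : s.Nonempty
  · refine le_antisymm ?_ ?_
    · -- `inf f′ + α₁ ≤ inf f`: for every fibre, `inf f′ + α₁ ≤ f′ a + α₁ = f a`
      refine Finset.le_inf fun a ha => ?_
      rw [← fiberSlopePS_hSucc_add hc₁ hA hA2 hfac hdeg (Finset.mem_range.mp ha)]
      exact add_le_add (Finset.inf_le ha) le_rfl
    · -- `inf f ≤ inf f′ + α₁`: bound every `f′ a + α₁ = f a` from below by `inf f`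
      obtain ⟨a₁, ha₁, h₁⟩ :
          ∃ i ∈ s, s.inf (fun a => fiberSlopePS A' 0 1 a) = fiberSlopePS A' 0 1 i :=
        Finset.exists_mem_eq_inf s hne _
      rw [h₁, fiberSlopePS_hSucc_add hc₁ hA hA2 hfac hdeg (Finset.mem_range.mp ha₁)]
      exact Finset.inf_le ha₁
  · rw [Finset.not_nonempty_iff_eq_empty] at hne
    rw [hne, Finset.inf_empty, Finset.inf_empty, top_add]

/-- … hence A STRICT DROP `slope(A′) < slope(A)` whenever the slope of `A` is finite (then `α₁ > 0`). [cite: HauserWagner2014, §6.2 p. 206] -/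
theorem slopePS_hSucc_lt (hc₁ : c₁ ≠ 0) (hA : A ≠ 0) (hA2 : (2 : ℕ∞) ≤ A.order)
    (hfac : subst (fun l : Fin 2 => if l = 1 then C c₁ * X 0 else (X 0 * X 1 : MvPowerSeries (Fin 2) K)) A = X 0 ^ 2 * A')
    (hdeg : degAlongPS A' 0 1 = degAlongPS A 1 0) (htop : slopePS A 1 0 ≠ ⊤) : slopePS A' 0 1 < slopePS A 1 0 := by
  have h := slopePS_hSucc_add hc₁ hA hA2 hfac hdeg
  -- `α₁ > 0`: a finite slope needs a fibre to the left of the highest vertex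
  have hα : 0 < degAlongPS A 1 0 := by
    by_contra h0
    apply htop
    rw [slopePS_def, Nat.eq_zero_of_not_pos h0, Finset.range_zero, Finset.inf_empty]
  have htop' : slopePS A' 0 1 ≠ ⊤ := by
    intro h'
    rw [h', top_add] at h
    exact htop h.symm
  rw [← h]
  obtain ⟨q, hq⟩ := WithTop.ne_top_iff_exists.mp htop'
  rw [← hq, ← WithTop.coe_natCast, ← WithTop.coe_add, WithTop.coe_lt_coe]
  have : (0 : ℚ) < (degAlongPS A 1 0 : ℚ) := by exact_mod_cast hα
  linarith

end HMove

end InsepNewton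

end Summit.ResolutionOfSingularities.ResolutionOfSingularities.Theorems
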